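import Summits.ResolutionOfSingularities.ResolutionOfSingularities.Theorems.WeightedInvariantTieFiniteGlobal
import Literature.AlgebraicGeometry.Resolution.SmoothStalksRegular
import HarnessLib

/-!
# (c8)≤d FOR THE STRATIFIER `ι₀ = (ν ; ε ; τ)` IN EVERY DIMENSION `d`: the tie points of a smooth quasi-compact scheme over a perfect field are
# finitely many (door `HypersurfaceCentreConstruction`, stmt-ResolutionOfSingularities-19897; P3 rung `stub_keyRungGrHomLE_three`, letter `τ`,
# graded clause hgr)

Topic: `Summits/ResolutionOfSingularities/ResolutionOfSingularities/Theorems`. Helper for the door item `HypersurfaceCentreConstruction`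
(stmt-ResolutionOfSingularities-19897, route `WeightedInvariant`), line `local-engine`, def-free.  Dimension-free sequel of
…IotaOrdEpsTauUpperSemicontinuousLE (`d = 3`): by the ring-level finiteness `TieFinite.finite_tiePrimes_global` (…TieFiniteGlobal) read on the affine
charts (whose coordinate rings are regular, `isRegularRing_sections_of_smooth`), the tie points of `(Y, f)` are finitely many on EVERY smooth
quasi-compact `Y` over a perfect field (`TieFinite.tiePoints_finite_of_smooth`), whence (c8τ)≤d and **(c8)≤d for `iotaOrdEpsTau`, every `d`, `p`**
(`Iota3.iotaTau_upperSemicontinuousOnLE`, `Iota3.iotaOrdEpsTau_upperSemicontinuousLE`) — the `ι₀`-layers of the graded clause hgr live on charts of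
dimension `3 + j`.
[OURS · L1 W4.3 · letter τ]  Replaces the role of NO printed item; NOT a statement of the manuscript under review [claim: Hironaka2017, status:
under-review]; candidates stay candidates; AI work, weaker than expert review.  No definition; no axiom.

## References

* A. Grothendieck, EGA I 1.3; The Stacks Project, Tag 056S (smooth over a field ⇒ regular). [folklore]
-/

noncomputable section

set_option linter.dupNamespace false -- mandated namespace `Summit.<Summit>.<Problem>` of this single-conjunct summit

open CategoryTheory AlgebraicGeometry TopologicalSpace IsLocalRing Topology
open Literature.AlgebraicGeometry.Resolution
open Summit.ResolutionOfSingularities.ResolutionOfSingularities.Theorems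

namespace Summit.ResolutionOfSingularities.ResolutionOfSingularities.Cruxes.HypersurfaceCentreConstruction.LocalEngine

namespace TieFinite

section Smooth

variable {k₀ : Type} [Field k₀] {Y : Scheme.{0}} (hY : Y ⟶ Spec (CommRingCat.of k₀)) [Smooth hY]

include hY in
/-- **The coordinate ring of an affine open of a scheme smooth over a field is a regular ring** (its localisations at primes are the stalks,
regular by Stacks 056S). [folklore] -/
theorem isRegularRing_sections_of_smooth (U : Y.affineOpens) : IsRegularRing Γ(Y, U) := by
  haveI : IsLocallyNoetherian Y := LocallyOfFiniteType.isLocallyNoetherian hY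
  haveI : IsNoetherianRing Γ(Y, U) := IsLocallyNoetherian.component_noetherian U
  refine isRegularRing_iff.mpr fun p hp => ?_
  have hy : U.2.fromSpec ⟨p, hp⟩ ∈ (U : Y.Opens) := U.2.range_fromSpec.le ⟨_, rfl⟩
  letI : Algebra Γ(Y, U) (Y.presheaf.stalk (U.2.fromSpec ⟨p, hp⟩)) :=
    TopCat.Presheaf.algebra_section_stalk Y.presheaf ⟨U.2.fromSpec ⟨p, hp⟩, hy⟩
  have hloc : IsLocalization.AtPrime (Y.presheaf.stalk (U.2.fromSpec ⟨p, hp⟩)) p := U.2.isLocalization_stalk' ⟨p, hp⟩ hy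
  haveI := isRegularLocalRing_stalk_of_smooth_of_field hY (U.2.fromSpec ⟨p, hp⟩)
  exact IsRegularLocalRing.of_ringEquiv
    (IsLocalization.algEquiv p.primeCompl (Y.presheaf.stalk (U.2.fromSpec ⟨p, hp⟩)) (Localization.AtPrime p)).toRingEquiv

variable [PerfectField k₀] [QuasiCompact hY]

include hY in
/-- **THE TIE POINTS OF A SMOOTH QUASI-COMPACT SCHEME OVER A PERFECT FIELD ARE FINITELY MANY — every dimension** (chart-wise
`TieFinite.finite_tiePrimes_global`, glued by `GenerizationClosed.finite_of_locally_finite`). [OURS · letter τ] -/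
theorem tiePoints_finite_of_smooth (f : Γ(Y, ⊤)) :
    {z : Y | Iota3.IsTiePosition (Y.presheaf.stalk z) ((Y.presheaf.germ ⊤ z trivial) f)}.Finite := by
  classical
  haveI : CompactSpace Y := QuasiCompact.compactSpace_of_compactSpace hY
  refine GenerizationClosed.finite_of_locally_finite fun y => ?_
  -- an affine chart through `y`; `Γ(Y, U)` is regular of finite type over `k₀`
  have hytop : y ∈ (⊤ : Y.Opens) := trivial
  rw [← iSup_affineOpens_eq_top Y] at hytop
  obtain ⟨U, hy⟩ := Opens.mem_iSup.mp hytop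
  have hft : RingHom.FiniteType (hY.appLE ⊤ U le_top).hom :=
    HasRingHomProperty.appLE @LocallyOfFiniteType hY inferInstance ⟨⊤, isAffineOpen_top _⟩ U le_top
  let φ : k₀ →+* Γ(Y, U) := (hY.appLE ⊤ U le_top).hom.comp (Scheme.ΓSpecIso (.of k₀)).inv.hom
  have hφ : φ.FiniteType :=
    hft.comp (RingHom.FiniteType.of_surjective _
      (Scheme.ΓSpecIso (.of k₀)).commRingCatIsoToRingEquiv.symm.surjective)
  letI : Algebra k₀ Γ(Y, U) := φ.toAlgebra
  haveI : Algebra.FiniteType k₀ Γ(Y, U) := hφ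
  haveI : IsRegularRing Γ(Y, U) := isRegularRing_sections_of_smooth hY U
  set F : Γ(Y, U) := Y.presheaf.map (homOfLE le_top).op f with hF
  refine ⟨(U : Y.Opens), U.1.isOpen, hy, ?_⟩
  refine ((finite_tiePrimes_global k₀ Γ(Y, U) F).image (fun 𝔮 : PrimeSpectrum Γ(Y, U) => (U.2.fromSpec 𝔮 : Y))).subset ?_
  rintro z ⟨hz, hzU⟩
  have hzU' : z ∈ (U : Y.Opens) := hzU
  exact ⟨U.2.primeIdealOf ⟨z, hzU'⟩, (isTiePosition_germ_iff_localization U f hzU').mp hz, U.2.fromSpec_primeIdealOf ⟨z, hzU'⟩⟩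

end Smooth

end TieFinite

namespace Iota3

/-- **(c8τ)≤d for every `d`, `p`**: `IotaUpperSemicontinuousOnLE d p iotaOrdEps iotaTau`. [OURS · (c8τ)≤d] -/
theorem iotaTau_upperSemicontinuousOnLE (d p : ℕ) : IotaUpperSemicontinuousOnLE d p iotaOrdEps iotaTau :=
  GenerizationClosed.indicator_upperSemicontinuousOnLE (fun R _ g => IsTiePosition R g) iotaTau
    (fun S _ g => iotaTau_eq_zero_or_eq_one S g) (fun S _ g => iotaTau_eq_one_iff_exists S g)
    (fun _ _ _ _ e g => (isTiePosition_ringEquiv_iff e g).symm) iotaOrdEps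
    (fun _ _ _ _ _ hY _ _ _ f => TieFinite.tiePoints_finite_of_smooth hY f)

/-- **(c8)≤d FOR THE STRATIFIER `ι₀ = (ν ; ε ; τ)`, EVERY `d`, `p`**: `IotaUpperSemicontinuousLE d p Iota3.iotaOrdEpsTau`. [OURS · (c8)≤d for ι₀] -/
theorem iotaOrdEpsTau_upperSemicontinuousLE (d p : ℕ) : IotaUpperSemicontinuousLE d p iotaOrdEpsTau := by
  unfold iotaOrdEpsTau
  exact iotaLex_upperSemicontinuousLE Ordinal.omega0_ne_zero iotaTau_boundedBy_omega0
    (iotaOrdEps_upperSemicontinuousLE d p) (iotaTau_upperSemicontinuousOnLE d p)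

end Iota3

end Summit.ResolutionOfSingularities.ResolutionOfSingularities.Cruxes.HypersurfaceCentreConstruction.LocalEngine

end
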